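import Literature.MathematicalPhysics.QuantumLattice.KomaTasakiTowerAverage

/-!
# Koma–Tasaki 1994, Theorem 2.4: Lemmas `hardLemma` and `subLemma` (the "hard lemma")

Towards the proof of the named fact `theorem_2_4` of `KomaTasakiSSB.lean` (T. Koma, H. Tasaki,
J. Stat. Phys. **76** (1994) 745–803, `KomaTasaki1994`, Section 5, Lemmas `hardLemma`–`subLemma`).

For a local operator `A = Σ a_x` (constant `a`) of `C`-charge `L - K` ("`A` consists of `K - L`
lowering operators", (dBound1)), words `u = u₁ ++ u₂`, `v = v₁ ++ v₂` with `K` letters `+` and `L`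
letters `-`, and under the smallness condition `KLCond (K + L)` (K+Lcond):

* (dB3) = Lemma `subLemma` (dBound3): `|⟨Φ, Π_{u₁} A Π_{u₂} Φ⟩ - ⟨Φ, Π_{v₁} A Π_{v₂} Φ⟩| ≤ δ(A; K, L)`;
* (dB1) = Lemma `hardLemma` (dBound1): `|⟨Φ, Π_{u₁} A Π_{u₂} Φ⟩ - c_J ⟨Φ, (O⁽¹⁾)^J A O^{(K-L)} (O⁽¹⁾)^J Φ⟩| ≤ δ`;
* (dB2) = Lemma `hardLemma` (dBound2): `|⟨Φ, Π_{u₁} A Π_{u₂} Φ⟩| ≤ 3 δ(A; K, L)`,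

`δ(A; K, L) = ½ (aN)(2oN)^{|K-L|} b_{min(K,L)}`, proved jointly by induction on `K + L` exactly as
in KT: (dB3) at level `n` from (dB2) at levels `n - 1` (moving `A` to the front, `D₁, D₃`, (D1<)–(D1<2)) and `n - 2` (reordering the word by adjacent transpositions, at most `KL` of them, each
costing `2γ (K+L) · 3δ(A; K-1, L-1)` by `[O⁻, O⁺] = -2γC` and `C Φ = 0`, `D₂`, (D2<)),
then (dB1) by the averaging identity (OBO1)–(OBO2) and (dB2) by the norm estimate for (dBound2). The case `A = 1` of KT is
the case `a = 1/N` (`U1System.isLocal_one`).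

Locators: equation labels such as `(bmDef)`, `(K+Lcond)`, `(dBound1)`, `(OBO2)`, `(Bunshi)` and the
lemma names `easyLemma`/`hardLemma`/`subLemma` (the three lemmas of §5, in this order) are those
of the arXiv source cond-mat/9708132 of `KomaTasaki1994`.

Consumers (2026-08-29): `AndersonTowerOfStatesUnconditional.lean` (KT94 Corollary 2.11 for the Heisenberg antiferromagnet
and hard-core bosons) via `KomaTasakiSSBTowerProofs.lean` (`TowerState.core`, `theorem_2_4_holds`).
-/

noncomputable section

open Complex Finset
open scoped InnerProductSpace ComplexConjugate

namespace Literature.MathematicalPhysics.QuantumLattice.KomaTasaki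

universe u v

variable {Λ : Type u} [Fintype Λ] {E : Type v} [NormedAddCommGroup E] [InnerProductSpace ℂ E]

/-! ### List bookkeeping -/

section Lists

omit [Fintype Λ]

/-- A word containing the letter `b` starts with a (possibly empty) block of `¬b` followed by `b`.
[folklore] -/
theorem exists_eq_replicate_append_cons (l : List Bool) (b : Bool) (h : l.count b ≠ 0) :
    ∃ (i : ℕ) (q : List Bool), l = List.replicate i (!b) ++ b :: q := by
  induction l with
  | nil => simp at h
  | cons c l ih =>
      by_cases hc : c = b
      · exact ⟨0, l, by simp [hc]⟩
      · have hc' : c = !b := by cases c <;> cases b <;> simp_all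
        have h' : l.count b ≠ 0 := by
          rw [List.count_cons] at h
          simpa [hc] using h
        obtain ⟨i, q, hq⟩ := ih h'
        exact ⟨i + 1, q, by rw [hq, hc', List.replicate_succ]; rfl⟩

/-- A word with no letters is empty. [folklore] -/
theorem eq_nil_of_count_eq_zero (l : List Bool) (ht : l.count true = 0) (hf : l.count false = 0) :
    l = [] := by
  have h := List.count_true_add_count_false l
  rw [ht, hf, zero_add] at h
  exact List.eq_nil_of_length_eq_zero h.symm

/-- A block of `-` contains no `+`. [folklore] -/
@[simp] theorem count_true_replicate_false (n : ℕ) : (List.replicate n false).count true = 0 :=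
  List.count_eq_zero.2 fun h => Bool.noConfusion (List.eq_of_mem_replicate h)

/-- A block of `+` contains no `-`. [folklore] -/
@[simp] theorem count_false_replicate_true (n : ℕ) : (List.replicate n true).count false = 0 :=
  List.count_eq_zero.2 fun h => Bool.noConfusion (List.eq_of_mem_replicate h)

end Lists

namespace TowerState

variable {sys : U1System Λ E} {Φ : E} {μ γ : ℝ}

/-! ### Elementary facts about `δ(A; K, L)` and the condition (K+Lcond) -/

/-- `δ` is symmetric in `K, L`. [cite: KomaTasaki1994, §5 (delta1)] -/
theorem delta_comm (a : ℝ) (K L : ℕ) : delta sys Φ a K L = delta sys Φ a L K := by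
  rw [delta_def, delta_def, max_comm, min_comm]

/-- `δ(A; K, L)` for `L ≤ K`. [cite: KomaTasaki1994, §5 (delta1)] -/
theorem delta_of_le (a : ℝ) {K L : ℕ} (h : L ≤ K) :
    delta sys Φ a K L = 1 / 2 * (a * Fintype.card Λ) * (2 * sys.oN) ^ (K - L) * bm sys Φ L := by
  rw [delta_def, max_eq_left h, min_eq_right h]

/-- `δ ≥ 0` for `a ≥ 0`. [cite: KomaTasaki1994, §5 (delta1)] -/
theorem delta_nonneg (hT : TowerState sys Φ μ γ) {a : ℝ} (ha : 0 ≤ a) (K L : ℕ) :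
    0 ≤ delta sys Φ a K L := by
  rw [delta_def]
  have := hT.oN_pos.le
  have := (hT.bm_pos (min K L)).le
  positivity

/-- The condition (K+Lcond) is monotone in `K + L`. [cite: KomaTasaki1994, §5 (K+Lcond)] -/
theorem klCond_mono (hT : TowerState sys Φ μ γ) {m n : ℕ} (hmn : m ≤ n) (h : KLCond sys μ γ n) :
    KLCond sys μ γ m := by
  rw [klCond_iff] at h ⊢
  have hN := hT.card_pos_real
  have hμ := hT.mu_pos
  have hγ := hT.gamma_pos.le
  have ho := sys.obar_pos
  have hm : (m : ℝ) ≤ n := by exact_mod_cast hmn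
  have h1 : 48 * sys.r / μ ^ 2 * ((m : ℝ) / Fintype.card Λ) ≤ 48 * sys.r / μ ^ 2 * ((n : ℝ) / Fintype.card Λ) := by
    gcongr
  have h2 : 3 * γ / (2 * sys.obar ^ 2 * μ ^ 2) * ((m : ℝ) ^ 3 / (Fintype.card Λ : ℝ) ^ 2) ≤
      3 * γ / (2 * sys.obar ^ 2 * μ ^ 2) * ((n : ℝ) ^ 3 / (Fintype.card Λ : ℝ) ^ 2) := by
    gcongr
  linarith

/-- (R1) Removing one `+` when `+` is in excess: `δ([O⁺,A]; K-1, L) = (2r/N) δ(A; K, L)` for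
`L < K` (constant `4 r o a` for the commutator). [cite: KomaTasaki1994, §5 (D1<)] -/
theorem delta_comm_pred_left_eq (hT : TowerState sys Φ μ γ) (a : ℝ) {K L : ℕ} (h : L + 1 ≤ K) :
    delta sys Φ (4 * sys.r * sys.obar * a) (K - 1) L = 2 * sys.r / Fintype.card Λ * delta sys Φ a K L := by
  have hN := hT.card_pos_real.ne'
  rw [delta_of_le _ (by omega : L ≤ K - 1), delta_of_le _ (by omega : L ≤ K),
    show K - L = (K - 1 - L) + 1 by omega, pow_succ, U1System.oN_def]
  field_simp
  ring

/-- (R2) Removing one `-` when `+` is (weakly) in excess costs the ratio `b_{L-1}/b_L ≤ (μ o N)⁻²`: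
`δ([O⁻,A]; K, L-1) ≤ (8r/(μ²N)) δ(A; K, L)` for `1 ≤ L ≤ K`. [cite: KomaTasaki1994, §5 (D1<2)] -/
theorem delta_comm_pred_right_le (hT : TowerState sys Φ μ γ) {a : ℝ} (ha : 0 ≤ a) {K L : ℕ}
    (hL : 1 ≤ L) (h : L ≤ K) :
    delta sys Φ (4 * sys.r * sys.obar * a) K (L - 1) ≤
      8 * sys.r / (μ ^ 2 * Fintype.card Λ) * delta sys Φ a K L := by
  have hN := hT.card_pos_real
  have hμ := hT.mu_pos
  have ho := sys.obar_pos
  have hoN := hT.oN_pos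
  have hb := hT.sq_mul_bm_le_succ (L - 1)
  rw [Nat.sub_add_cancel hL] at hb
  rw [delta_of_le _ (by omega : L - 1 ≤ K), delta_of_le _ h, show K - (L - 1) = (K - L) + 1 by omega,
    pow_succ]
  -- LHS = Cf * b_{L-1}, RHS = Cf * b_L / (μ oN)²
  have hμoN : 0 < (μ * sys.oN) ^ 2 := by positivity
  have key : bm sys Φ (L - 1) ≤ bm sys Φ L / (μ * sys.oN) ^ 2 := by
    rw [le_div_iff₀ hμoN]; linarith
  calc 1 / 2 * (4 * sys.r * sys.obar * a * Fintype.card Λ) * ((2 * sys.oN) ^ (K - L) * (2 * sys.oN)) *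
        bm sys Φ (L - 1)
      ≤ 1 / 2 * (4 * sys.r * sys.obar * a * Fintype.card Λ) * ((2 * sys.oN) ^ (K - L) * (2 * sys.oN)) *
        (bm sys Φ L / (μ * sys.oN) ^ 2) := by
        apply mul_le_mul_of_nonneg_left key
        positivity
    _ = 8 * sys.r / (μ ^ 2 * Fintype.card Λ) *
        (1 / 2 * (a * Fintype.card Λ) * (2 * sys.oN) ^ (K - L) * bm sys Φ L) := by
        rw [U1System.oN_def]
        field_simp
        ring

/-- (R4) Removing one `+` and one `-`: `δ(A; K-1, L-1) ≤ δ(A; K, L)/(μ o N)²` for `K, L ≥ 1`.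
[cite: KomaTasaki1994, §5 (D2<)] -/
theorem delta_pred_pred_le (hT : TowerState sys Φ μ γ) {a : ℝ} (ha : 0 ≤ a) {K L : ℕ}
    (hK : 1 ≤ K) (hL : 1 ≤ L) :
    delta sys Φ a (K - 1) (L - 1) ≤ delta sys Φ a K L / (μ * sys.oN) ^ 2 := by
  have hN := hT.card_pos_real
  have hoN := hT.oN_pos
  have hμoN : 0 < (μ * sys.oN) ^ 2 := by have := hT.mu_pos; positivity
  have hb := hT.sq_mul_bm_le_succ (min K L - 1)
  have hmin : 1 ≤ min K L := le_min hK hL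
  rw [Nat.sub_add_cancel hmin] at hb
  rw [delta_def, delta_def, show max (K - 1) (L - 1) - min (K - 1) (L - 1) = max K L - min K L by omega,
    show min (K - 1) (L - 1) = min K L - 1 by omega, le_div_iff₀ hμoN]
  calc 1 / 2 * (a * Fintype.card Λ) * (2 * sys.oN) ^ (max K L - min K L) * bm sys Φ (min K L - 1) *
        (μ * sys.oN) ^ 2
      = 1 / 2 * (a * Fintype.card Λ) * (2 * sys.oN) ^ (max K L - min K L) *
        ((μ * sys.oN) ^ 2 * bm sys Φ (min K L - 1)) := by ring
    _ ≤ 1 / 2 * (a * Fintype.card Λ) * (2 * sys.oN) ^ (max K L - min K L) * bm sys Φ (min K L) := by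
        apply mul_le_mul_of_nonneg_left hb
        positivity

/-- The uniform form of (R1)–(R3): removing a letter `s` that occurs costs at most
`(8r/(μ²N)) δ(A; K, L)` (for `s = +`: `δ(4roa; K-1, L)`; here for `K ≥ 1`).
[cite: KomaTasaki1994, §5 (D1<)–(D1<2)] -/
theorem delta_remove_true_le (hT : TowerState sys Φ μ γ) {a : ℝ} (ha : 0 ≤ a) {K L : ℕ} (hK : 1 ≤ K) :
    delta sys Φ (4 * sys.r * sys.obar * a) (K - 1) L ≤
      8 * sys.r / (μ ^ 2 * Fintype.card Λ) * delta sys Φ a K L := by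
  have hN := hT.card_pos_real
  have hμ := hT.mu_pos
  have hμ1 := hT.mu_le_one
  rcases lt_or_ge L K with hlt | hge
  · -- `L < K`: exact ratio `2r/N ≤ 8r/(μ²N)`
    rw [hT.delta_comm_pred_left_eq a (by omega)]
    apply mul_le_mul_of_nonneg_right _ (hT.delta_nonneg ha K L)
    rw [div_le_div_iff₀ hN (by positivity)]
    have hr : (0 : ℝ) ≤ sys.r := Nat.cast_nonneg _
    have hμ2 : μ ^ 2 ≤ 1 := by nlinarith
    have h0 : 0 ≤ (1 - μ ^ 2) * ((sys.r : ℝ) * Fintype.card Λ) :=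
      mul_nonneg (sub_nonneg.mpr hμ2) (mul_nonneg hr hN.le)
    nlinarith
  · -- `K ≤ L`: this is (R2) for the transposed pair
    rw [delta_comm (sys := sys) (Φ := Φ) _ (K - 1) L, delta_comm (sys := sys) (Φ := Φ) a K L]
    exact hT.delta_comm_pred_right_le ha hK hge

/-- The mirror image: removing a `-` (for `L ≥ 1`) costs at most `(8r/(μ²N)) δ(A; K, L)`.
[cite: KomaTasaki1994, §5 (D1<)–(D1<2)] -/
theorem delta_remove_false_le (hT : TowerState sys Φ μ γ) {a : ℝ} (ha : 0 ≤ a) {K L : ℕ} (hL : 1 ≤ L) :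
    delta sys Φ (4 * sys.r * sys.obar * a) K (L - 1) ≤
      8 * sys.r / (μ ^ 2 * Fintype.card Λ) * delta sys Φ a K L := by
  rw [delta_comm (sys := sys) (Φ := Φ) _ K (L - 1), delta_comm (sys := sys) (Φ := Φ) a K L]
  exact hT.delta_remove_true_le ha hL

/-! ### Moving `A` to the front (`D₁`, `D₃`) -/

/-- `Π_{p ++ [s]} A Π_q - Π_p A Π_{s :: q} = Π_p [O^s, A] Π_q`. [cite: KomaTasaki1994, §5 (D1<)] -/
theorem wordOp_comm_single (sys : U1System Λ E) (A : E →L[ℂ] E) (p q : List Bool) (s : Bool) :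
    sys.wordOp (p ++ [s]) * A * sys.wordOp q - sys.wordOp p * A * sys.wordOp (s :: q) =
      sys.wordOp p * (sys.sgnOp s * A - A * sys.sgnOp s) * sys.wordOp q := by
  simp only [U1System.wordOp_append, U1System.wordOp_cons, U1System.wordOp_nil, mul_one, mul_sub,
    sub_mul, mul_assoc]

/-- **`D₁`/`D₃` (D1<)–(D1<2):** moving `A` from position `k` to the front costs at most
`#⁺(u₁) βₜ + #⁻(u₁) β_f`, where `β_s` bounds every term `⟨Φ, Π_p [O^s, A] Π_q Φ⟩`.
[cite: KomaTasaki1994, §5 (D1<)–(D1<2)] -/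
theorem move_left (A : E →L[ℂ] E) (K L : ℕ) (βt βf : ℝ)
    (Ht : ∀ p q : List Bool, (p ++ true :: q).count true = K → (p ++ true :: q).count false = L →
      ‖⟪Φ, (sys.wordOp p * (sys.sgnOp true * A - A * sys.sgnOp true) * sys.wordOp q) Φ⟫_ℂ‖ ≤ βt)
    (Hf : ∀ p q : List Bool, (p ++ false :: q).count true = K → (p ++ false :: q).count false = L →
      ‖⟪Φ, (sys.wordOp p * (sys.sgnOp false * A - A * sys.sgnOp false) * sys.wordOp q) Φ⟫_ℂ‖ ≤ βf)
    (u₁ : List Bool) :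
    ∀ p u₂ : List Bool, (p ++ u₁ ++ u₂).count true = K → (p ++ u₁ ++ u₂).count false = L →
      ‖⟪Φ, (sys.wordOp (p ++ u₁) * A * sys.wordOp u₂) Φ⟫_ℂ -
          ⟪Φ, (sys.wordOp p * A * sys.wordOp (u₁ ++ u₂)) Φ⟫_ℂ‖ ≤
        u₁.count true * βt + u₁.count false * βf := by
  induction u₁ with
  | nil => intro p u₂ _ _; simp
  | cons s w ih =>
      intro p u₂ ht hf
      have e1 : p ++ s :: w = p ++ [s] ++ w := by simp
      have ht' : (p ++ [s] ++ w ++ u₂).count true = K := by simpa using ht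
      have hf' : (p ++ [s] ++ w ++ u₂).count false = L := by simpa using hf
      have h1 := ih (p ++ [s]) u₂ ht' hf'
      -- the single commutator term
      have h2 : ‖⟪Φ, (sys.wordOp (p ++ [s]) * A * sys.wordOp (w ++ u₂)) Φ⟫_ℂ -
          ⟪Φ, (sys.wordOp p * A * sys.wordOp (s :: (w ++ u₂))) Φ⟫_ℂ‖ ≤
          (if s then βt else βf) := by
        rw [← inner_sub_right, ← sub_apply, wordOp_comm_single]
        have htq : (p ++ s :: (w ++ u₂)).count true = K := by simpa using ht
        have hfq : (p ++ s :: (w ++ u₂)).count false = L := by simpa using hf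
        cases s
        · exact Hf p (w ++ u₂) htq hfq
        · exact Ht p (w ++ u₂) htq hfq
      rw [e1]
      have e2 : s :: w ++ u₂ = s :: (w ++ u₂) := rfl
      rw [e2]
      calc ‖⟪Φ, (sys.wordOp (p ++ [s] ++ w) * A * sys.wordOp u₂) Φ⟫_ℂ -
            ⟪Φ, (sys.wordOp p * A * sys.wordOp (s :: (w ++ u₂))) Φ⟫_ℂ‖
          ≤ ‖⟪Φ, (sys.wordOp (p ++ [s] ++ w) * A * sys.wordOp u₂) Φ⟫_ℂ -
              ⟪Φ, (sys.wordOp (p ++ [s]) * A * sys.wordOp (w ++ u₂)) Φ⟫_ℂ‖ +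
            ‖⟪Φ, (sys.wordOp (p ++ [s]) * A * sys.wordOp (w ++ u₂)) Φ⟫_ℂ -
              ⟪Φ, (sys.wordOp p * A * sys.wordOp (s :: (w ++ u₂))) Φ⟫_ℂ‖ :=
            norm_sub_le_norm_sub_add_norm_sub _ _ _
        _ ≤ (w.count true * βt + w.count false * βf) + (if s then βt else βf) := add_le_add h1 h2
        _ = (s :: w).count true * βt + (s :: w).count false * βf := by
            cases s <;> simp <;> ring

/-! ### Reordering the word by adjacent transpositions (`D₂`) -/

/-- Bubbling a `+` to the left through `i` letters `-` costs `i β₂` if each adjacent swap costs `β₂`.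
[cite: KomaTasaki1994, §5 (D2<)] -/
theorem bubble_true (A : E →L[ℂ] E) (K L : ℕ) {β₂ : ℝ}
    (HS : ∀ p q : List Bool, (p ++ false :: true :: q).count true = K →
      (p ++ false :: true :: q).count false = L →
      ‖⟪Φ, (A * sys.wordOp (p ++ false :: true :: q)) Φ⟫_ℂ -
          ⟪Φ, (A * sys.wordOp (p ++ true :: false :: q)) Φ⟫_ℂ‖ ≤ β₂)
    (i : ℕ) :
    ∀ p q : List Bool, (p ++ List.replicate i false ++ true :: q).count true = K →
      (p ++ List.replicate i false ++ true :: q).count false = L →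
      ‖⟪Φ, (A * sys.wordOp (p ++ List.replicate i false ++ true :: q)) Φ⟫_ℂ -
          ⟪Φ, (A * sys.wordOp (p ++ true :: (List.replicate i false ++ q))) Φ⟫_ℂ‖ ≤ i * β₂ := by
  induction i with
  | zero => intro p q _ _; simp
  | succ i ih =>
      intro p q ht hf
      have e1 : p ++ List.replicate (i + 1) false ++ true :: q =
          (p ++ [false]) ++ List.replicate i false ++ true :: q := by
        simp [List.replicate_succ]
      have ht' : ((p ++ [false]) ++ List.replicate i false ++ true :: q).count true = K := by
        rw [← e1]; exact ht
      have hf' : ((p ++ [false]) ++ List.replicate i false ++ true :: q).count false = L := by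
        rw [← e1]; exact hf
      have h1 := ih (p ++ [false]) q ht' hf'
      have e2 : (p ++ [false]) ++ true :: (List.replicate i false ++ q) =
          p ++ false :: true :: (List.replicate i false ++ q) := by simp
      rw [e2] at h1
      have hts : (p ++ false :: true :: (List.replicate i false ++ q)).count true = K := by
        have := ht'; simp [List.count_append] at this ⊢; omega
      have hfs : (p ++ false :: true :: (List.replicate i false ++ q)).count false = L := by
        have := hf'; simp [List.count_append] at this ⊢; omega
      have h2 := HS p (List.replicate i false ++ q) hts hfs
      have e3 : p ++ true :: false :: (List.replicate i false ++ q) =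
          p ++ true :: (List.replicate (i + 1) false ++ q) := by simp [List.replicate_succ]
      rw [e3] at h2
      rw [e1]
      calc _ ≤ ‖⟪Φ, (A * sys.wordOp (p ++ [false] ++ List.replicate i false ++ true :: q)) Φ⟫_ℂ -
              ⟪Φ, (A * sys.wordOp (p ++ false :: true :: (List.replicate i false ++ q))) Φ⟫_ℂ‖ +
            ‖⟪Φ, (A * sys.wordOp (p ++ false :: true :: (List.replicate i false ++ q))) Φ⟫_ℂ -
              ⟪Φ, (A * sys.wordOp (p ++ true :: (List.replicate (i + 1) false ++ q))) Φ⟫_ℂ‖ :=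
            norm_sub_le_norm_sub_add_norm_sub _ _ _
        _ ≤ i * β₂ + β₂ := add_le_add h1 h2
        _ = (i + 1 : ℕ) * β₂ := by push_cast; ring

/-- Bubbling a `-` to the left through `i` letters `+` costs `i β₂`. [cite: KomaTasaki1994, §5 (D2<)] -/
theorem bubble_false (A : E →L[ℂ] E) (K L : ℕ) {β₂ : ℝ}
    (HS : ∀ p q : List Bool, (p ++ false :: true :: q).count true = K →
      (p ++ false :: true :: q).count false = L →
      ‖⟪Φ, (A * sys.wordOp (p ++ false :: true :: q)) Φ⟫_ℂ -
          ⟪Φ, (A * sys.wordOp (p ++ true :: false :: q)) Φ⟫_ℂ‖ ≤ β₂)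
    (i : ℕ) :
    ∀ p q : List Bool, (p ++ List.replicate i true ++ false :: q).count true = K →
      (p ++ List.replicate i true ++ false :: q).count false = L →
      ‖⟪Φ, (A * sys.wordOp (p ++ List.replicate i true ++ false :: q)) Φ⟫_ℂ -
          ⟪Φ, (A * sys.wordOp (p ++ false :: (List.replicate i true ++ q))) Φ⟫_ℂ‖ ≤ i * β₂ := by
  induction i with
  | zero => intro p q _ _; simp
  | succ i ih =>
      intro p q ht hf
      have e1 : p ++ List.replicate (i + 1) true ++ false :: q =
          (p ++ [true]) ++ List.replicate i true ++ false :: q := by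
        simp [List.replicate_succ]
      have ht' : ((p ++ [true]) ++ List.replicate i true ++ false :: q).count true = K := by
        rw [← e1]; exact ht
      have hf' : ((p ++ [true]) ++ List.replicate i true ++ false :: q).count false = L := by
        rw [← e1]; exact hf
      have h1 := ih (p ++ [true]) q ht' hf'
      have e2 : (p ++ [true]) ++ false :: (List.replicate i true ++ q) =
          p ++ true :: false :: (List.replicate i true ++ q) := by simp
      rw [e2] at h1
      have hts : (p ++ false :: true :: (List.replicate i true ++ q)).count true = K := by
        have := ht'; simp [List.count_append] at this ⊢; omega
      have hfs : (p ++ false :: true :: (List.replicate i true ++ q)).count false = L := by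
        have := hf'; simp [List.count_append] at this ⊢; omega
      have h2 := HS p (List.replicate i true ++ q) hts hfs
      have e3 : p ++ false :: true :: (List.replicate i true ++ q) =
          p ++ false :: (List.replicate (i + 1) true ++ q) := by simp [List.replicate_succ]
      rw [e3] at h2
      rw [e1]
      calc _ ≤ ‖⟪Φ, (A * sys.wordOp (p ++ [true] ++ List.replicate i true ++ false :: q)) Φ⟫_ℂ -
              ⟪Φ, (A * sys.wordOp (p ++ true :: false :: (List.replicate i true ++ q))) Φ⟫_ℂ‖ +
            ‖⟪Φ, (A * sys.wordOp (p ++ true :: false :: (List.replicate i true ++ q))) Φ⟫_ℂ -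
              ⟪Φ, (A * sys.wordOp (p ++ false :: (List.replicate (i + 1) true ++ q))) Φ⟫_ℂ‖ :=
            norm_sub_le_norm_sub_add_norm_sub _ _ _
        _ ≤ i * β₂ + β₂ := add_le_add h1 (by rw [norm_sub_rev]; exact h2)
        _ = (i + 1 : ℕ) * β₂ := by push_cast; ring

/-- **`D₂` (D2<):** two words with the same letters (after a common prefix `p`) differ, in
`⟨Φ, A Π_w Φ⟩`, by at most `#⁺(w) #⁻(w) β₂` ("at most `KL` exchanges are necessary").
[cite: KomaTasaki1994, §5 (D2<)] -/
theorem reorder (A : E →L[ℂ] E) (K L : ℕ) {β₂ : ℝ} (hβ : 0 ≤ β₂)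
    (HS : ∀ p q : List Bool, (p ++ false :: true :: q).count true = K →
      (p ++ false :: true :: q).count false = L →
      ‖⟪Φ, (A * sys.wordOp (p ++ false :: true :: q)) Φ⟫_ℂ -
          ⟪Φ, (A * sys.wordOp (p ++ true :: false :: q)) Φ⟫_ℂ‖ ≤ β₂)
    (w : List Bool) :
    ∀ w' p : List Bool, (p ++ w).count true = K → (p ++ w).count false = L →
      w'.count true = w.count true → w'.count false = w.count false →
      ‖⟪Φ, (A * sys.wordOp (p ++ w)) Φ⟫_ℂ - ⟪Φ, (A * sys.wordOp (p ++ w')) Φ⟫_ℂ‖ ≤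
        w.count true * w.count false * β₂ := by
  induction w with
  | nil =>
      intro w' p _ _ hct hcf
      rw [List.count_nil] at hct hcf
      rw [eq_nil_of_count_eq_zero w' hct hcf]
      simp
  | cons s t ih =>
      intro w' p ht hf hct hcf
      -- peel the first letter of `w'`
      cases w' with
      | nil => cases s <;> simp at hct hcf
      | cons s' t' =>
        by_cases hs : s' = s
        · subst hs
          have e1 : p ++ s' :: t = (p ++ [s']) ++ t := by simp
          have e2 : p ++ s' :: t' = (p ++ [s']) ++ t' := by simp
          rw [e1, e2]
          have hct' : t'.count true = t.count true := by
            cases s' <;> simp at hct <;> omega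
          have hcf' : t'.count false = t.count false := by
            cases s' <;> simp at hcf <;> omega
          have h := ih t' (p ++ [s']) (by rw [← e1]; exact ht) (by rw [← e1]; exact hf) hct' hcf'
          refine h.trans ?_
          have h1 : (t.count true : ℝ) ≤ (s' :: t).count true := by
            exact_mod_cast List.count_le_count_cons
          have h2 : (t.count false : ℝ) ≤ (s' :: t).count false := by
            exact_mod_cast List.count_le_count_cons
          have := mul_le_mul h1 h2 (by positivity) (by positivity)
          exact mul_le_mul_of_nonneg_right this hβ
        · cases s with
          | true =>
            -- `w = + :: t`, `w' = - :: t'`; `w'` contains a `+`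
            have hs' : s' = false := by cases s' <;> simp_all
            subst hs'
            have hpos : (false :: t').count true ≠ 0 := by rw [hct]; simp
            obtain ⟨i, q, hq⟩ := exists_eq_replicate_append_cons (false :: t') true hpos
            simp only [Bool.not_true] at hq
            -- counts of the pieces
            have hctq : (List.replicate i false ++ q).count true = t.count true := by
              have := hct; rw [hq] at this; simp [List.count_append] at this ⊢; omega
            have hcfq : (List.replicate i false ++ q).count false = t.count false := by
              have := hcf; rw [hq] at this; simp [List.count_append] at this ⊢; omega
            have hi : (i : ℝ) ≤ t.count false := by
              have : i ≤ (List.replicate i false ++ q).count false := by simp [List.count_append]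
              rw [hcfq] at this; exact_mod_cast this
            -- step 1: `w` versus `+ :: (replicate i - ++ q)` through the induction hypothesis
            have e1 : p ++ true :: t = (p ++ [true]) ++ t := by simp
            have h1 := ih (List.replicate i false ++ q) (p ++ [true]) (by rw [← e1]; exact ht)
              (by rw [← e1]; exact hf) hctq hcfq
            have e2 : (p ++ [true]) ++ (List.replicate i false ++ q) =
                p ++ true :: (List.replicate i false ++ q) := by simp
            rw [← e1, e2] at h1
            -- step 2: bubble the `+` of `w'` to the front
            have htw' : (p ++ List.replicate i false ++ true :: q).count true = K := by
              rw [List.append_assoc, ← hq, ← ht]; simp [List.count_append, hct]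
            have hfw' : (p ++ List.replicate i false ++ true :: q).count false = L := by
              rw [List.append_assoc, ← hq, ← hf]; simp [List.count_append, hcf]
            have h2 := bubble_true (sys := sys) (Φ := Φ) A K L HS i p q htw' hfw'
            rw [List.append_assoc, ← hq] at h2
            calc ‖⟪Φ, (A * sys.wordOp (p ++ true :: t)) Φ⟫_ℂ - ⟪Φ, (A * sys.wordOp (p ++ false :: t')) Φ⟫_ℂ‖
                ≤ ‖⟪Φ, (A * sys.wordOp (p ++ true :: t)) Φ⟫_ℂ -
                    ⟪Φ, (A * sys.wordOp (p ++ true :: (List.replicate i false ++ q))) Φ⟫_ℂ‖ +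
                  ‖⟪Φ, (A * sys.wordOp (p ++ true :: (List.replicate i false ++ q))) Φ⟫_ℂ -
                    ⟪Φ, (A * sys.wordOp (p ++ false :: t')) Φ⟫_ℂ‖ :=
                  norm_sub_le_norm_sub_add_norm_sub _ _ _
              _ ≤ t.count true * t.count false * β₂ + i * β₂ :=
                  add_le_add h1 (by rw [norm_sub_rev]; exact h2)
              _ ≤ t.count true * t.count false * β₂ + t.count false * β₂ := by gcongr
              _ = (true :: t).count true * (true :: t).count false * β₂ := by simp; ring
          | false =>
            have hs' : s' = true := by cases s' <;> simp_all
            subst hs'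
            have hpos : (true :: t').count false ≠ 0 := by rw [hcf]; simp
            obtain ⟨i, q, hq⟩ := exists_eq_replicate_append_cons (true :: t') false hpos
            simp only [Bool.not_false] at hq
            have hctq : (List.replicate i true ++ q).count true = t.count true := by
              have := hct; rw [hq] at this; simp [List.count_append] at this ⊢; omega
            have hcfq : (List.replicate i true ++ q).count false = t.count false := by
              have := hcf; rw [hq] at this; simp [List.count_append] at this ⊢; omega
            have hi : (i : ℝ) ≤ t.count true := by
              have : i ≤ (List.replicate i true ++ q).count true := by simp [List.count_append]
              rw [hctq] at this; exact_mod_cast this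
            have e1 : p ++ false :: t = (p ++ [false]) ++ t := by simp
            have h1 := ih (List.replicate i true ++ q) (p ++ [false]) (by rw [← e1]; exact ht)
              (by rw [← e1]; exact hf) hctq hcfq
            have e2 : (p ++ [false]) ++ (List.replicate i true ++ q) =
                p ++ false :: (List.replicate i true ++ q) := by simp
            rw [← e1, e2] at h1
            have htw' : (p ++ List.replicate i true ++ false :: q).count true = K := by
              rw [List.append_assoc, ← hq, ← ht]; simp [List.count_append, hct]
            have hfw' : (p ++ List.replicate i true ++ false :: q).count false = L := by
              rw [List.append_assoc, ← hq, ← hf]; simp [List.count_append, hcf]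
            have h2 := bubble_false (sys := sys) (Φ := Φ) A K L HS i p q htw' hfw'
            rw [List.append_assoc, ← hq] at h2
            calc ‖⟪Φ, (A * sys.wordOp (p ++ false :: t)) Φ⟫_ℂ - ⟪Φ, (A * sys.wordOp (p ++ true :: t')) Φ⟫_ℂ‖
                ≤ ‖⟪Φ, (A * sys.wordOp (p ++ false :: t)) Φ⟫_ℂ -
                    ⟪Φ, (A * sys.wordOp (p ++ false :: (List.replicate i true ++ q))) Φ⟫_ℂ‖ +
                  ‖⟪Φ, (A * sys.wordOp (p ++ false :: (List.replicate i true ++ q))) Φ⟫_ℂ -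
                    ⟪Φ, (A * sys.wordOp (p ++ true :: t')) Φ⟫_ℂ‖ :=
                  norm_sub_le_norm_sub_add_norm_sub _ _ _
              _ ≤ t.count true * t.count false * β₂ + i * β₂ :=
                  add_le_add h1 (by rw [norm_sub_rev]; exact h2)
              _ ≤ t.count true * t.count false * β₂ + t.count true * β₂ := by gcongr
              _ = (false :: t).count true * (false :: t).count false * β₂ := by simp; ring

/-! ### The cost of one adjacent transposition -/

/-- **One exchange (D2<):** `|⟨Φ, A Π_p O⁻O⁺ Π_q Φ⟩ - ⟨Φ, A Π_p O⁺O⁻ Π_q Φ⟩| = 2γ |charge(q)| |⟨Φ, A Π_{p++q} Φ⟩|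
≤ 2γ (K+L) |⟨Φ, A Π_{p ++ q} Φ⟩|`, by `[O⁻, O⁺] = -2γ C` and `C Π_q Φ = charge(q) Π_q Φ`.
[cite: KomaTasaki1994, §5 (D2<)] -/
theorem swap_cost (hT : TowerState sys Φ μ γ) (A : E →L[ℂ] E) (p q : List Bool) :
    ‖⟪Φ, (A * sys.wordOp (p ++ false :: true :: q)) Φ⟫_ℂ -
        ⟪Φ, (A * sys.wordOp (p ++ true :: false :: q)) Φ⟫_ℂ‖ ≤
      2 * γ * (p ++ false :: true :: q).length * ‖⟪Φ, (A * sys.wordOp (p ++ q)) Φ⟫_ℂ‖ := by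
  rw [← inner_sub_right, ← sub_apply, ← mul_sub, hT.wordOp_swap, mul_neg, neg_apply, inner_neg_right,
    norm_neg, mul_smul_comm, smul_apply, inner_smul_right]
  have hC : (A * (sys.wordOp p * sys.C * sys.wordOp q)) Φ =
      (U1System.wordCharge q : ℂ) • (A * sys.wordOp (p ++ q)) Φ := by
    rw [U1System.wordOp_append]
    simp only [mul_apply_eq_comp]
    rw [U1System.C_wordOp_apply hT.C_apply, map_smul, map_smul]
  rw [hC, inner_smul_right]
  have hγ : ‖(2 * (γ : ℂ))‖ = 2 * γ := by
    rw [norm_mul, Complex.norm_ofNat, Complex.norm_real, Real.norm_eq_abs, abs_of_pos hT.gamma_pos]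
  rw [norm_mul (2 * (γ : ℂ)), norm_mul (U1System.wordCharge q : ℂ), hγ]
  have hq : ‖(U1System.wordCharge q : ℂ)‖ ≤ (p ++ false :: true :: q).length := by
    rw [Complex.norm_intCast, U1System.wordCharge]
    have h1 := List.count_true_add_count_false q
    have h2 : q.length ≤ (p ++ false :: true :: q).length := by
      simp only [List.length_append, List.length_cons]; omega
    rw [← Int.cast_abs]
    have : |((q.count true : ℤ)) - (q.count false : ℤ)| ≤ ((p ++ false :: true :: q).length : ℤ) := by
      rw [abs_le]; constructor <;> omega
    exact_mod_cast this
  have h2γ : 0 ≤ 2 * γ := by have := hT.gamma_pos; positivity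
  calc 2 * γ * (‖(U1System.wordCharge q : ℂ)‖ * ‖⟪Φ, (A * sys.wordOp (p ++ q)) Φ⟫_ℂ‖)
      ≤ 2 * γ * ((p ++ false :: true :: q).length * ‖⟪Φ, (A * sys.wordOp (p ++ q)) Φ⟫_ℂ‖) := by
        apply mul_le_mul_of_nonneg_left _ h2γ
        exact mul_le_mul_of_nonneg_right hq (norm_nonneg _)
    _ = _ := by ring

/-! ### From (dB3) to (dB1) and (dB2) -/

/-- **Lemma `hardLemma`, (dBound1) from Lemma `subLemma`:** if all sandwiched terms with the same letters are within `δ`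
of each other, each is within `δ` of `c_J ⟨Φ, (O⁽¹⁾)^J A O^{(K-L)} (O⁽¹⁾)^J Φ⟩` (`J = min{K,L}`;
`O^{(K-L)} = Π_{pw}` for any word `pw` with `K - J` letters `+` and `L - J` letters `-`).
[cite: KomaTasaki1994, §5 Lemma `hardLemma` (dBound1), via (OBO2)] -/
theorem dB1_of_dB3 (hT : TowerState sys Φ μ γ) {A : E →L[ℂ] E} {a : ℝ} {K L : ℕ}
    (hq : sys.HasCharge A ((L : ℤ) - K))
    (h3 : ∀ u₁ u₂ v₁ v₂ : List Bool,
      (u₁ ++ u₂).count true = K → (u₁ ++ u₂).count false = L →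
      (v₁ ++ v₂).count true = K → (v₁ ++ v₂).count false = L →
      ‖⟪Φ, (sys.wordOp u₁ * A * sys.wordOp u₂) Φ⟫_ℂ -
          ⟪Φ, (sys.wordOp v₁ * A * sys.wordOp v₂) Φ⟫_ℂ‖ ≤ delta sys Φ a K L)
    (pw : List Bool) (hpt : pw.count true = K - min K L) (hpf : pw.count false = L - min K L)
    (u₁ u₂ : List Bool) (hut : (u₁ ++ u₂).count true = K) (huf : (u₁ ++ u₂).count false = L) :
    ‖⟪Φ, (sys.wordOp u₁ * A * sys.wordOp u₂) Φ⟫_ℂ -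
        (cCoef (min K L) : ℂ) *
          ⟪Φ, (sys.order 0 ^ min K L * (A * sys.wordOp pw) * sys.order 0 ^ min K L) Φ⟫_ℂ‖ ≤
      delta sys Φ a K L := by
  have hKJ : min K L ≤ K := min_le_left _ _
  have hLJ : min K L ≤ L := min_le_right _ _
  have hB : sys.HasCharge (A * sys.wordOp pw) 0 := by
    have h := hq.mul (sys.hasCharge_wordOp pw)
    have e : (L : ℤ) - K + U1System.wordCharge pw = 0 := by
      rw [U1System.wordCharge, hpt, hpf]; push_cast [Nat.cast_sub hKJ, Nat.cast_sub hLJ]; ring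
    rwa [e] at h
  refine sys.norm_sub_cCoef_mul_inner_le hB hT.C_apply (min K L) _ ?_
  intro τ₁ τ₂ hτ
  have e : sys.wordOp (List.ofFn τ₁) * (A * sys.wordOp pw) * sys.wordOp (List.ofFn τ₂) =
      sys.wordOp (List.ofFn τ₁) * A * sys.wordOp (pw ++ List.ofFn τ₂) := by
    rw [U1System.wordOp_append]; simp only [mul_assoc]
  rw [e]
  have h₁ := List.count_true_add_count_false (List.ofFn τ₁)
  have h₂ := List.count_true_add_count_false (List.ofFn τ₂)
  rw [List.length_ofFn] at h₁ h₂
  apply h3 u₁ u₂ _ _ hut huf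
  · simp only [List.count_append, hpt]; omega
  · simp only [List.count_append, hpf]; omega

/-- **Lemma `hardLemma`, (dBound2) from (dBound1):** `|⟨Φ, Π_{u₁} A Π_{u₂} Φ⟩| ≤ 3 δ(A; K, L)`, using
`c_J |⟨Φ, (O⁽¹⁾)^J B (O⁽¹⁾)^J Φ⟩| ≤ ‖B‖ b_J ≤ (aN)(2oN)^{|K-L|} b_J = 2δ` the norm estimate for (dBound2).
[cite: KomaTasaki1994, §5 Lemma `hardLemma` (dBound2)] -/
theorem dB2_of_dB1 (hT : TowerState sys Φ μ γ) {A : E →L[ℂ] E} {a : ℝ} {K L : ℕ}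
    (hA : sys.IsLocal A a)
    (pw : List Bool) (hpt : pw.count true = K - min K L) (hpf : pw.count false = L - min K L)
    (h1 : ∀ u₁ u₂ : List Bool, (u₁ ++ u₂).count true = K → (u₁ ++ u₂).count false = L →
      ‖⟪Φ, (sys.wordOp u₁ * A * sys.wordOp u₂) Φ⟫_ℂ -
        (cCoef (min K L) : ℂ) *
          ⟪Φ, (sys.order 0 ^ min K L * (A * sys.wordOp pw) * sys.order 0 ^ min K L) Φ⟫_ℂ‖ ≤
      delta sys Φ a K L)
    (u₁ u₂ : List Bool) (hut : (u₁ ++ u₂).count true = K) (huf : (u₁ ++ u₂).count false = L) :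
    ‖⟪Φ, (sys.wordOp u₁ * A * sys.wordOp u₂) Φ⟫_ℂ‖ ≤ 3 * delta sys Φ a K L := by
  set J := min K L with hJ
  set S := ⟪Φ, (sys.order 0 ^ J * (A * sys.wordOp pw) * sys.order 0 ^ J) Φ⟫_ℂ with hS
  have hd := h1 u₁ u₂ hut huf
  have hlen : pw.length = max K L - min K L := by
    have h := List.count_true_add_count_false pw
    rw [hpt, hpf] at h; omega
  have h2oN : 0 ≤ 2 * sys.oN := by have := hT.oN_pos; positivity
  have hnormB : ‖A * sys.wordOp pw‖ ≤ a * Fintype.card Λ * (2 * sys.oN) ^ (max K L - min K L) := by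
    calc ‖A * sys.wordOp pw‖ ≤ ‖A‖ * ‖sys.wordOp pw‖ := norm_mul_le _ _
      _ ≤ (a * Fintype.card Λ) * (2 * sys.oN) ^ pw.length := by
          have h := sys.norm_wordOp_le pw
          rw [U1System.two_mul_obar_mul_card] at h
          exact mul_le_mul hA.norm_le h (norm_nonneg _)
            ((norm_nonneg _).trans hA.norm_le)
      _ = _ := by rw [hlen]
  have hsand : cCoef J * ‖S‖ ≤ 2 * delta sys Φ a K L := by
    calc cCoef J * ‖S‖ ≤ ‖A * sys.wordOp pw‖ * bm sys Φ J :=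
          sys.cCoef_mul_norm_inner_sandwich_le _ J Φ
      _ ≤ (a * Fintype.card Λ * (2 * sys.oN) ^ (max K L - min K L)) * bm sys Φ J :=
          mul_le_mul_of_nonneg_right hnormB (hT.bm_pos J).le
      _ = 2 * delta sys Φ a K L := by rw [delta_def, ← hJ]; ring
  have hcS : ‖(cCoef J : ℂ) * S‖ = cCoef J * ‖S‖ := by
    rw [norm_mul, Complex.norm_real, Real.norm_eq_abs, abs_of_pos (cCoef_pos J)]
  calc ‖⟪Φ, (sys.wordOp u₁ * A * sys.wordOp u₂) Φ⟫_ℂ‖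
      = ‖(⟪Φ, (sys.wordOp u₁ * A * sys.wordOp u₂) Φ⟫_ℂ - (cCoef J : ℂ) * S) + (cCoef J : ℂ) * S‖ := by
        rw [sub_add_cancel]
    _ ≤ ‖⟪Φ, (sys.wordOp u₁ * A * sys.wordOp u₂) Φ⟫_ℂ - (cCoef J : ℂ) * S‖ + ‖(cCoef J : ℂ) * S‖ :=
        norm_add_le _ _
    _ ≤ delta sys Φ a K L + 2 * delta sys Φ a K L := add_le_add hd (hcS ▸ hsand)
    _ = 3 * delta sys Φ a K L := by ring

/-! ### The induction step for (dB3) -/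

omit [Fintype Λ] in
/-- `6 K L (K + L) ≤ (3/2) (K + L)³`, i.e. `KL ≤ (K+L)²/4` (KT, end of the proof of Lemma `subLemma`). [cite: KomaTasaki1994, §5 (D2<)] -/
theorem six_mul_le {x y : ℝ} (hx : 0 ≤ x) (hy : 0 ≤ y) : 6 * (x * y * (x + y)) ≤ 3 / 2 * (x + y) ^ 3 := by
  nlinarith [mul_nonneg (add_nonneg hx hy) (sq_nonneg (x - y))]

/-- **Lemma `subLemma`, induction step (Ddecomp)–(D2<).** Given the bounds of level `K + L - 1` on the
commutator terms `⟨Φ, Π_p [O^±, A] Π_q Φ⟩` and of level `K + L - 2` on `⟨Φ, A Π_{p++q} Φ⟩` (both in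
the form produced by (dB2) at those levels), the sandwiched expectations at level `K + L` are within
`D₁ + D₂ + D₃ ≤ {48r(K+L)/(μ²N) + 6γKL(K+L)/(μ²o²N²)} δ ≤ δ` of each other.
[cite: KomaTasaki1994, §5 Lemma `subLemma` (Ddecomp)–(D2<)] -/
theorem dB3_step (hT : TowerState sys Φ μ γ) {A : E →L[ℂ] E} {a : ℝ} (ha : 0 ≤ a) {K L : ℕ}
    (hKL : KLCond sys μ γ (K + L))
    (Ht : ∀ p q : List Bool, (p ++ true :: q).count true = K → (p ++ true :: q).count false = L →
      ‖⟪Φ, (sys.wordOp p * (sys.sgnOp true * A - A * sys.sgnOp true) * sys.wordOp q) Φ⟫_ℂ‖ ≤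
        3 * delta sys Φ (4 * sys.r * sys.obar * a) (K - 1) L)
    (Hf : ∀ p q : List Bool, (p ++ false :: q).count true = K → (p ++ false :: q).count false = L →
      ‖⟪Φ, (sys.wordOp p * (sys.sgnOp false * A - A * sys.sgnOp false) * sys.wordOp q) Φ⟫_ℂ‖ ≤
        3 * delta sys Φ (4 * sys.r * sys.obar * a) K (L - 1))
    (H2 : ∀ p q : List Bool, (p ++ false :: true :: q).count true = K →
      (p ++ false :: true :: q).count false = L →
      ‖⟪Φ, (A * sys.wordOp (p ++ q)) Φ⟫_ℂ‖ ≤ 3 * delta sys Φ a (K - 1) (L - 1))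
    (u₁ u₂ v₁ v₂ : List Bool)
    (hut : (u₁ ++ u₂).count true = K) (huf : (u₁ ++ u₂).count false = L)
    (hvt : (v₁ ++ v₂).count true = K) (hvf : (v₁ ++ v₂).count false = L) :
    ‖⟪Φ, (sys.wordOp u₁ * A * sys.wordOp u₂) Φ⟫_ℂ - ⟪Φ, (sys.wordOp v₁ * A * sys.wordOp v₂) Φ⟫_ℂ‖ ≤
      delta sys Φ a K L := by
  have hN := hT.card_pos_real
  have hμ := hT.mu_pos
  have ho := sys.obar_pos
  have hoN := hT.oN_pos
  have hγ := hT.gamma_pos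
  set δ := delta sys Φ a K L with hδ
  set βt := 3 * delta sys Φ (4 * sys.r * sys.obar * a) (K - 1) L with hβt
  set βf := 3 * delta sys Φ (4 * sys.r * sys.obar * a) K (L - 1) with hβf
  set β₂ := 2 * γ * (K + L) * (3 * delta sys Φ a (K - 1) (L - 1)) with hβ₂
  have hδ0 : 0 ≤ δ := hT.delta_nonneg ha K L
  have hδ2 : 0 ≤ delta sys Φ a (K - 1) (L - 1) := hT.delta_nonneg ha _ _
  have hβ₂0 : 0 ≤ β₂ := by rw [hβ₂]; positivity
  -- the swap hypothesis from `H2`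
  have HS : ∀ p q : List Bool, (p ++ false :: true :: q).count true = K →
      (p ++ false :: true :: q).count false = L →
      ‖⟪Φ, (A * sys.wordOp (p ++ false :: true :: q)) Φ⟫_ℂ -
          ⟪Φ, (A * sys.wordOp (p ++ true :: false :: q)) Φ⟫_ℂ‖ ≤ β₂ := by
    intro p q hpt hpf
    have hlen : ((p ++ false :: true :: q).length : ℝ) = K + L := by
      have h := List.count_true_add_count_false (p ++ false :: true :: q)
      rw [hpt, hpf] at h; exact_mod_cast h.symm
    refine (hT.swap_cost A p q).trans ?_
    rw [hlen, hβ₂]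
    exact mul_le_mul_of_nonneg_left (H2 p q hpt hpf) (by positivity)
  -- `D₁`, `D₃`, `D₂`
  have D1 := move_left (sys := sys) (Φ := Φ) A K L βt βf Ht Hf u₁ [] u₂ (by simpa using hut)
    (by simpa using huf)
  have D3 := move_left (sys := sys) (Φ := Φ) A K L βt βf Ht Hf v₁ [] v₂ (by simpa using hvt)
    (by simpa using hvf)
  simp only [List.nil_append, U1System.wordOp_nil, one_mul] at D1 D3
  have D2 := reorder (sys := sys) (Φ := Φ) A K L hβ₂0 HS (u₁ ++ u₂) (v₁ ++ v₂) [] (by simpa using hut)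
    (by simpa using huf) (by rw [hvt, hut]) (by rw [hvf, huf])
  simp only [List.nil_append, hut, huf] at D2
  -- counts of `u₁`, `v₁` are at most `K`, `L`
  have hu1t : (u₁.count true : ℝ) ≤ K := by
    have : u₁.count true ≤ (u₁ ++ u₂).count true := by simp
    rw [hut] at this; exact_mod_cast this
  have hu1f : (u₁.count false : ℝ) ≤ L := by
    have : u₁.count false ≤ (u₁ ++ u₂).count false := by simp
    rw [huf] at this; exact_mod_cast this
  have hv1t : (v₁.count true : ℝ) ≤ K := by
    have : v₁.count true ≤ (v₁ ++ v₂).count true := by simp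
    rw [hvt] at this; exact_mod_cast this
  have hv1f : (v₁.count false : ℝ) ≤ L := by
    have : v₁.count false ≤ (v₁ ++ v₂).count false := by simp
    rw [hvf] at this; exact_mod_cast this
  -- the ratio bounds: `K βt ≤ K (24r/(μ²N)) δ`, `L βf ≤ L (24r/(μ²N)) δ`, `KL β₂ ≤ KL 2γ(K+L) 3δ/(μoN)²`
  have hβt0 : 0 ≤ βt := by rw [hβt]; exact mul_nonneg (by norm_num) (hT.delta_nonneg (by positivity) _ _)
  have hβf0 : 0 ≤ βf := by rw [hβf]; exact mul_nonneg (by norm_num) (hT.delta_nonneg (by positivity) _ _)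
  have RK : (K : ℝ) * βt ≤ K * (3 * (8 * sys.r / (μ ^ 2 * Fintype.card Λ) * δ)) := by
    rcases Nat.eq_zero_or_pos K with hK | hK
    · simp [hK]
    · apply mul_le_mul_of_nonneg_left _ (Nat.cast_nonneg K)
      rw [hβt]
      exact mul_le_mul_of_nonneg_left (hT.delta_remove_true_le ha hK) (by norm_num)
  have RL : (L : ℝ) * βf ≤ L * (3 * (8 * sys.r / (μ ^ 2 * Fintype.card Λ) * δ)) := by
    rcases Nat.eq_zero_or_pos L with hL | hL
    · simp [hL]
    · apply mul_le_mul_of_nonneg_left _ (Nat.cast_nonneg L)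
      rw [hβf]
      exact mul_le_mul_of_nonneg_left (hT.delta_remove_false_le ha hL) (by norm_num)
  have RKL : (K : ℝ) * L * β₂ ≤ K * L * (2 * γ * (K + L) * (3 * (δ / (μ * sys.oN) ^ 2))) := by
    rcases Nat.eq_zero_or_pos K with hK | hK
    · simp [hK]
    rcases Nat.eq_zero_or_pos L with hL | hL
    · simp [hL]
    apply mul_le_mul_of_nonneg_left _ (by positivity)
    rw [hβ₂]
    apply mul_le_mul_of_nonneg_left _ (by positivity)
    exact mul_le_mul_of_nonneg_left (hT.delta_pred_pred_le ha hK hL) (by norm_num)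
  -- assemble `D ≤ D₁ + D₂ + D₃`
  have hD : ‖⟪Φ, (sys.wordOp u₁ * A * sys.wordOp u₂) Φ⟫_ℂ - ⟪Φ, (sys.wordOp v₁ * A * sys.wordOp v₂) Φ⟫_ℂ‖ ≤
      (u₁.count true * βt + u₁.count false * βf) + K * L * β₂ + (v₁.count true * βt + v₁.count false * βf) := by
    calc _ ≤ ‖⟪Φ, (sys.wordOp u₁ * A * sys.wordOp u₂) Φ⟫_ℂ - ⟪Φ, (A * sys.wordOp (u₁ ++ u₂)) Φ⟫_ℂ‖ +
          ‖⟪Φ, (A * sys.wordOp (u₁ ++ u₂)) Φ⟫_ℂ - ⟪Φ, (sys.wordOp v₁ * A * sys.wordOp v₂) Φ⟫_ℂ‖ :=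
          norm_sub_le_norm_sub_add_norm_sub _ _ _
      _ ≤ ‖⟪Φ, (sys.wordOp u₁ * A * sys.wordOp u₂) Φ⟫_ℂ - ⟪Φ, (A * sys.wordOp (u₁ ++ u₂)) Φ⟫_ℂ‖ +
          (‖⟪Φ, (A * sys.wordOp (u₁ ++ u₂)) Φ⟫_ℂ - ⟪Φ, (A * sys.wordOp (v₁ ++ v₂)) Φ⟫_ℂ‖ +
            ‖⟪Φ, (A * sys.wordOp (v₁ ++ v₂)) Φ⟫_ℂ - ⟪Φ, (sys.wordOp v₁ * A * sys.wordOp v₂) Φ⟫_ℂ‖) := by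
          gcongr; exact norm_sub_le_norm_sub_add_norm_sub _ _ _
      _ ≤ (u₁.count true * βt + u₁.count false * βf) + (K * L * β₂ +
            (v₁.count true * βt + v₁.count false * βf)) := by
          refine add_le_add D1 (add_le_add D2 ?_)
          rw [norm_sub_rev]; exact D3
      _ = _ := by ring
  -- numeric conclusion
  have hKr : (0 : ℝ) ≤ K := Nat.cast_nonneg K
  have hLr : (0 : ℝ) ≤ L := Nat.cast_nonneg L
  have hsum : (u₁.count true * βt + u₁.count false * βf) + K * L * β₂ +
      (v₁.count true * βt + v₁.count false * βf) ≤
      2 * (K * (3 * (8 * sys.r / (μ ^ 2 * Fintype.card Λ) * δ)) +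
        L * (3 * (8 * sys.r / (μ ^ 2 * Fintype.card Λ) * δ))) +
        K * L * (2 * γ * (K + L) * (3 * (δ / (μ * sys.oN) ^ 2))) := by
    have h1 : u₁.count true * βt ≤ K * βt := mul_le_mul_of_nonneg_right hu1t hβt0
    have h2 : u₁.count false * βf ≤ L * βf := mul_le_mul_of_nonneg_right hu1f hβf0
    have h3 : v₁.count true * βt ≤ K * βt := mul_le_mul_of_nonneg_right hv1t hβt0
    have h4 : v₁.count false * βf ≤ L * βf := mul_le_mul_of_nonneg_right hv1f hβf0
    linarith
  refine hD.trans (hsum.trans ?_)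
  -- `= {48 r (K+L)/(μ²N) + 6γ K L (K+L)/(μ² o² N²)} δ ≤ KLCond-expression · δ ≤ δ`
  rw [klCond_iff] at hKL
  have e1 : 2 * (K * (3 * (8 * sys.r / (μ ^ 2 * Fintype.card Λ) * δ)) +
        L * (3 * (8 * sys.r / (μ ^ 2 * Fintype.card Λ) * δ))) =
      (48 * sys.r / μ ^ 2 * (((K + L : ℕ) : ℝ) / Fintype.card Λ)) * δ := by
    push_cast; ring
  have e2 : (K : ℝ) * L * (2 * γ * (K + L) * (3 * (δ / (μ * sys.oN) ^ 2))) =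
      (γ / (sys.obar ^ 2 * μ ^ 2 * (Fintype.card Λ : ℝ) ^ 2) * δ) * (6 * (K * L * (K + L))) := by
    rw [U1System.oN_def]; ring
  have e3 : 3 * γ / (2 * sys.obar ^ 2 * μ ^ 2) * ((((K + L : ℕ) : ℝ)) ^ 3 / (Fintype.card Λ : ℝ) ^ 2) * δ =
      (γ / (sys.obar ^ 2 * μ ^ 2 * (Fintype.card Λ : ℝ) ^ 2) * δ) * (3 / 2 * ((K : ℝ) + L) ^ 3) := by
    push_cast; ring
  have h6 : 6 * ((K : ℝ) * L * (K + L)) ≤ 3 / 2 * ((K : ℝ) + L) ^ 3 := six_mul_le hKr hLr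
  have hcoef : 0 ≤ γ / (sys.obar ^ 2 * μ ^ 2 * (Fintype.card Λ : ℝ) ^ 2) * δ := by positivity
  calc 2 * (K * (3 * (8 * sys.r / (μ ^ 2 * Fintype.card Λ) * δ)) +
        L * (3 * (8 * sys.r / (μ ^ 2 * Fintype.card Λ) * δ))) +
        K * L * (2 * γ * (K + L) * (3 * (δ / (μ * sys.oN) ^ 2)))
      = (48 * sys.r / μ ^ 2 * (((K + L : ℕ) : ℝ) / Fintype.card Λ)) * δ +
        (γ / (sys.obar ^ 2 * μ ^ 2 * (Fintype.card Λ : ℝ) ^ 2) * δ) * (6 * (K * L * (K + L))) := by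
        rw [e1, e2]
    _ ≤ (48 * sys.r / μ ^ 2 * (((K + L : ℕ) : ℝ) / Fintype.card Λ)) * δ +
        (γ / (sys.obar ^ 2 * μ ^ 2 * (Fintype.card Λ : ℝ) ^ 2) * δ) * (3 / 2 * ((K : ℝ) + L) ^ 3) :=
        add_le_add le_rfl (mul_le_mul_of_nonneg_left h6 hcoef)
    _ = (48 * sys.r / μ ^ 2 * (((K + L : ℕ) : ℝ) / Fintype.card Λ)) * δ +
        3 * γ / (2 * sys.obar ^ 2 * μ ^ 2) * ((((K + L : ℕ) : ℝ)) ^ 3 / (Fintype.card Λ : ℝ) ^ 2) * δ := by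
        rw [e3]
    _ = (48 * sys.r / μ ^ 2 * (((K + L : ℕ) : ℝ) / Fintype.card Λ) +
        3 * γ / (2 * sys.obar ^ 2 * μ ^ 2) * ((((K + L : ℕ) : ℝ)) ^ 3 / (Fintype.card Λ : ℝ) ^ 2)) * δ := by
        ring
    _ ≤ 1 * δ := mul_le_mul_of_nonneg_right hKL hδ0
    _ = δ := one_mul δ

/-! ### The joint induction (Lemmas `hardLemma` and `subLemma`) -/

/-- **KT Lemma `hardLemma`, (dBound2), by induction on `K + L`** (carrying (dB2) as the induction
hypothesis; Lemma `subLemma` and (dBound1) are re-derived at each level inside the step).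
[cite: KomaTasaki1994, §5 Lemmas `hardLemma`, `subLemma`] -/
theorem dB2_induction (hT : TowerState sys Φ μ γ) (n : ℕ) :
    ∀ (K L : ℕ) (A : E →L[ℂ] E) (a : ℝ), K + L = n → KLCond sys μ γ (K + L) →
      sys.IsLocal A a → sys.HasCharge A ((L : ℤ) - K) →
      ∀ u₁ u₂ : List Bool, (u₁ ++ u₂).count true = K → (u₁ ++ u₂).count false = L →
        ‖⟪Φ, (sys.wordOp u₁ * A * sys.wordOp u₂) Φ⟫_ℂ‖ ≤ 3 * delta sys Φ a K L := by
  induction n using Nat.strong_induction_on with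
  | _ n IH =>
    intro K L A a hn hKL hA hq
    haveI := hT.nonempty
    have ha : 0 ≤ a := hA.nonneg
    -- level `n - 1`: the commutator terms
    have Ht : ∀ p q : List Bool, (p ++ true :: q).count true = K → (p ++ true :: q).count false = L →
        ‖⟪Φ, (sys.wordOp p * (sys.sgnOp true * A - A * sys.sgnOp true) * sys.wordOp q) Φ⟫_ℂ‖ ≤
          3 * delta sys Φ (4 * sys.r * sys.obar * a) (K - 1) L := by
      intro p q hpt hpf
      rcases Nat.eq_zero_or_pos K with hK | hK
      · exfalso; rw [hK] at hpt; simp [List.count_append] at hpt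
      · have hq' : sys.HasCharge (sys.sgnOp true * A - A * sys.sgnOp true) ((L : ℤ) - (K - 1 : ℕ)) := by
          have := hq.comm_sgnOp true
          rw [U1System.bsign_true] at this
          rwa [show (L : ℤ) - ((K - 1 : ℕ) : ℤ) = (L : ℤ) - K + 1 by push_cast [Nat.cast_sub hK]; ring]
        refine IH (n - 1) (by omega) (K - 1) L _ _ (by omega)
          (hT.klCond_mono (by omega) hKL) (hA.comm_sgnOp true) hq' p q ?_ ?_
        · have := hpt; simp [List.count_append] at this ⊢; omega
        · have := hpf; simp [List.count_append] at this ⊢; omega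
    have Hf : ∀ p q : List Bool, (p ++ false :: q).count true = K → (p ++ false :: q).count false = L →
        ‖⟪Φ, (sys.wordOp p * (sys.sgnOp false * A - A * sys.sgnOp false) * sys.wordOp q) Φ⟫_ℂ‖ ≤
          3 * delta sys Φ (4 * sys.r * sys.obar * a) K (L - 1) := by
      intro p q hpt hpf
      rcases Nat.eq_zero_or_pos L with hL | hL
      · exfalso; rw [hL] at hpf; simp [List.count_append] at hpf
      · have hq' : sys.HasCharge (sys.sgnOp false * A - A * sys.sgnOp false) (((L - 1 : ℕ) : ℤ) - K) := by
          have := hq.comm_sgnOp false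
          rw [U1System.bsign_false] at this
          rwa [show ((L - 1 : ℕ) : ℤ) - (K : ℤ) = (L : ℤ) - K + (-1) by push_cast [Nat.cast_sub hL]; ring]
        refine IH (n - 1) (by omega) K (L - 1) _ _ (by omega)
          (hT.klCond_mono (by omega) hKL) (hA.comm_sgnOp false) hq' p q ?_ ?_
        · have := hpt; simp [List.count_append] at this ⊢; omega
        · have := hpf; simp [List.count_append] at this ⊢; omega
    -- level `n - 2`: after removing one `+` and one `-`
    have H2 : ∀ p q : List Bool, (p ++ false :: true :: q).count true = K →
        (p ++ false :: true :: q).count false = L →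
        ‖⟪Φ, (A * sys.wordOp (p ++ q)) Φ⟫_ℂ‖ ≤ 3 * delta sys Φ a (K - 1) (L - 1) := by
      intro p q hpt hpf
      rcases Nat.eq_zero_or_pos K with hK | hK
      · exfalso; rw [hK] at hpt; simp [List.count_append] at hpt
      rcases Nat.eq_zero_or_pos L with hL | hL
      · exfalso; rw [hL] at hpf; simp [List.count_append] at hpf
      have hq' : sys.HasCharge A (((L - 1 : ℕ) : ℤ) - (K - 1 : ℕ)) := by
        rwa [show ((L - 1 : ℕ) : ℤ) - ((K - 1 : ℕ) : ℤ) = (L : ℤ) - K by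
          push_cast [Nat.cast_sub hK, Nat.cast_sub hL]; ring]
      have h := IH (n - 2) (by omega) (K - 1) (L - 1) A a (by omega)
        (hT.klCond_mono (by omega) hKL) hA hq' [] (p ++ q) ?_ ?_
      · simpa using h
      · have := hpt; simp [List.count_append] at this ⊢; omega
      · have := hpf; simp [List.count_append] at this ⊢; omega
    -- level `n`: (dB3), then (dB1), then (dB2)
    have h3 := hT.dB3_step ha hKL Ht Hf H2
    -- a pad word
    obtain ⟨pw, hpt, hpf⟩ : ∃ pw : List Bool, pw.count true = K - min K L ∧ pw.count false = L - min K L := by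
      rcases le_total L K with h | h
      · refine ⟨List.replicate (K - L) true, ?_, ?_⟩ <;> simp [min_eq_right h]
      · refine ⟨List.replicate (L - K) false, ?_, ?_⟩ <;> simp [min_eq_left h]
    have h1 := hT.dB1_of_dB3 hq h3 pw hpt hpf
    exact hT.dB2_of_dB1 hA pw hpt hpf h1

/-- **KT Lemma `hardLemma`, (dBound2):** for a local operator `A` (constant `a`) of charge `L - K`, under
condition (K+Lcond) on `K + L`, every sandwiched expectation `⟨Φ, Π_{u₁} A Π_{u₂} Φ⟩` over a word
with `K` letters `+` and `L` letters `-` is at most `3 δ(A; K, L)` in modulus.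
[cite: KomaTasaki1994, §5 Lemma `hardLemma` (dBound2)] -/
theorem norm_inner_sandwich_word_le (hT : TowerState sys Φ μ γ) {K L : ℕ} {A : E →L[ℂ] E} {a : ℝ}
    (hKL : KLCond sys μ γ (K + L)) (hA : sys.IsLocal A a) (hq : sys.HasCharge A ((L : ℤ) - K))
    (u₁ u₂ : List Bool) (hut : (u₁ ++ u₂).count true = K) (huf : (u₁ ++ u₂).count false = L) :
    ‖⟪Φ, (sys.wordOp u₁ * A * sys.wordOp u₂) Φ⟫_ℂ‖ ≤ 3 * delta sys Φ a K L :=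
  hT.dB2_induction (K + L) K L A a rfl hKL hA hq u₁ u₂ hut huf

/-- **KT Lemma `subLemma`, (dBound3):** under the same hypotheses, two sandwiched expectations over words
with the same letters differ by at most `δ(A; K, L)`. [cite: KomaTasaki1994, §5 Lemma `subLemma` (dBound3)] -/
theorem norm_sub_inner_sandwich_word_le (hT : TowerState sys Φ μ γ) {K L : ℕ} {A : E →L[ℂ] E}
    {a : ℝ} (hKL : KLCond sys μ γ (K + L)) (hA : sys.IsLocal A a)
    (hq : sys.HasCharge A ((L : ℤ) - K)) (u₁ u₂ v₁ v₂ : List Bool)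
    (hut : (u₁ ++ u₂).count true = K) (huf : (u₁ ++ u₂).count false = L)
    (hvt : (v₁ ++ v₂).count true = K) (hvf : (v₁ ++ v₂).count false = L) :
    ‖⟪Φ, (sys.wordOp u₁ * A * sys.wordOp u₂) Φ⟫_ℂ - ⟪Φ, (sys.wordOp v₁ * A * sys.wordOp v₂) Φ⟫_ℂ‖ ≤
      delta sys Φ a K L := by
  haveI := hT.nonempty
  have ha : 0 ≤ a := hA.nonneg
  refine hT.dB3_step ha hKL ?_ ?_ ?_ u₁ u₂ v₁ v₂ hut huf hvt hvf
  · intro p q hpt hpf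
    rcases Nat.eq_zero_or_pos K with hK | hK
    · exfalso; rw [hK] at hpt; simp [List.count_append] at hpt
    · have hq' : sys.HasCharge (sys.sgnOp true * A - A * sys.sgnOp true) ((L : ℤ) - (K - 1 : ℕ)) := by
        have := hq.comm_sgnOp true
        rw [U1System.bsign_true] at this
        rwa [show (L : ℤ) - ((K - 1 : ℕ) : ℤ) = (L : ℤ) - K + 1 by push_cast [Nat.cast_sub hK]; ring]
      refine hT.norm_inner_sandwich_word_le (K := K - 1) (L := L) ?_ (hA.comm_sgnOp true) hq' p q ?_ ?_
      · exact hT.klCond_mono (by omega) hKL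
      · have := hpt; simp [List.count_append] at this ⊢; omega
      · have := hpf; simp [List.count_append] at this ⊢; omega
  · intro p q hpt hpf
    rcases Nat.eq_zero_or_pos L with hL | hL
    · exfalso; rw [hL] at hpf; simp [List.count_append] at hpf
    · have hq' : sys.HasCharge (sys.sgnOp false * A - A * sys.sgnOp false) (((L - 1 : ℕ) : ℤ) - K) := by
        have := hq.comm_sgnOp false
        rw [U1System.bsign_false] at this
        rwa [show ((L - 1 : ℕ) : ℤ) - (K : ℤ) = (L : ℤ) - K + (-1) by push_cast [Nat.cast_sub hL]; ring]
      refine hT.norm_inner_sandwich_word_le (K := K) (L := L - 1) ?_ (hA.comm_sgnOp false) hq' p q ?_ ?_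
      · exact hT.klCond_mono (by omega) hKL
      · have := hpt; simp [List.count_append] at this ⊢; omega
      · have := hpf; simp [List.count_append] at this ⊢; omega
  · intro p q hpt hpf
    rcases Nat.eq_zero_or_pos K with hK | hK
    · exfalso; rw [hK] at hpt; simp [List.count_append] at hpt
    rcases Nat.eq_zero_or_pos L with hL | hL
    · exfalso; rw [hL] at hpf; simp [List.count_append] at hpf
    have hq' : sys.HasCharge A (((L - 1 : ℕ) : ℤ) - (K - 1 : ℕ)) := by
      rwa [show ((L - 1 : ℕ) : ℤ) - ((K - 1 : ℕ) : ℤ) = (L : ℤ) - K by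
          push_cast [Nat.cast_sub hK, Nat.cast_sub hL]; ring]
    have h := hT.norm_inner_sandwich_word_le (K := K - 1) (L := L - 1) (hT.klCond_mono (by omega) hKL)
      hA hq' [] (p ++ q) ?_ ?_
    · simpa using h
    · have := hpt; simp [List.count_append] at this ⊢; omega
    · have := hpf; simp [List.count_append] at this ⊢; omega

/-- **KT Lemma `hardLemma`, (dBound1):** `|⟨Φ, Π_{u₁} A Π_{u₂} Φ⟩ - c_J ⟨Φ, (O⁽¹⁾)^J A Π_{pw} (O⁽¹⁾)^J Φ⟩| ≤ δ(A; K, L)`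
for any word `pw` with `K - J` letters `+` and `L - J` letters `-` (KT: `A O^{+(K-L)}`).
[cite: KomaTasaki1994, §5 Lemma `hardLemma` (dBound1)] -/
theorem norm_sub_cCoef_inner_le (hT : TowerState sys Φ μ γ) {K L : ℕ} {A : E →L[ℂ] E} {a : ℝ}
    (hKL : KLCond sys μ γ (K + L)) (hA : sys.IsLocal A a) (hq : sys.HasCharge A ((L : ℤ) - K))
    (pw : List Bool) (hpt : pw.count true = K - min K L) (hpf : pw.count false = L - min K L)
    (u₁ u₂ : List Bool) (hut : (u₁ ++ u₂).count true = K) (huf : (u₁ ++ u₂).count false = L) :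
    ‖⟪Φ, (sys.wordOp u₁ * A * sys.wordOp u₂) Φ⟫_ℂ -
        (cCoef (min K L) : ℂ) *
          ⟪Φ, (sys.order 0 ^ min K L * (A * sys.wordOp pw) * sys.order 0 ^ min K L) Φ⟫_ℂ‖ ≤
      delta sys Φ a K L :=
  hT.dB1_of_dB3 hq (fun u₁ u₂ v₁ v₂ hut huf hvt hvf =>
    hT.norm_sub_inner_sandwich_word_le hKL hA hq u₁ u₂ v₁ v₂ hut huf hvt hvf) pw hpt hpf u₁ u₂ hut huf

/-- **(Bunbo): `‖(O⁺)^M Φ‖² = ⟨Φ, (O⁻)^M (O⁺)^M Φ⟩ ≥ ½ b_M`** under condition (K+Lcond) on `2M`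
(Lemma `hardLemma` with `A = 1`, `K = L = M`). In particular `(O⁺)^M Φ ≠ 0`.
[cite: KomaTasaki1994, §5 (Bunbo)] -/
theorem half_bm_le_norm_sq (hT : TowerState sys Φ μ γ) {M : ℕ} (hKL : KLCond sys μ γ (M + M)) :
    1 / 2 * bm sys Φ M ≤ ‖(sys.orderPlus ^ M) Φ‖ ^ 2 := by
  haveI := hT.nonempty
  have hA := sys.isLocal_one
  have hq : sys.HasCharge (1 : E →L[ℂ] E) ((M : ℤ) - M) := by rw [sub_self]; exact sys.hasCharge_one
  have h := hT.norm_sub_cCoef_inner_le hKL hA hq [] (by simp) (by simp)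
    (List.replicate M false) (List.replicate M true) (by simp) (by simp)
  have hT' : ⟪Φ, (sys.wordOp (List.replicate M false) * 1 * sys.wordOp (List.replicate M true)) Φ⟫_ℂ
      = ((‖(sys.orderPlus ^ M) Φ‖ ^ 2 : ℝ) : ℂ) := by
    rw [mul_one, mul_apply_eq_comp, U1System.inner_wordOp_right, U1System.wrev_replicate,
      Bool.not_false, U1System.wordOp_replicate, U1System.sgnOp_true, inner_self_eq_norm_sq_to_K]
    norm_cast
  have hS : (cCoef (min M M) : ℂ) *
      ⟪Φ, (sys.order 0 ^ min M M * (1 * sys.wordOp []) * sys.order 0 ^ min M M) Φ⟫_ℂ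
      = ((bm sys Φ M : ℝ) : ℂ) := by
    rw [min_self, U1System.wordOp_nil, mul_one, mul_one, ← pow_add, ← two_mul,
      inner_pow_two_mul_apply (sys.isSymmetric_order 0), bm_eq]
    push_cast; ring
  have hδ : delta sys Φ (Fintype.card Λ : ℝ)⁻¹ M M = 1 / 2 * bm sys Φ M := by
    rw [delta_def, min_self, max_self, Nat.sub_self, pow_zero, mul_one,
      inv_mul_cancel₀ hT.card_pos_real.ne', mul_one]
  rw [hT', hS, hδ, ← Complex.ofReal_sub, Complex.norm_real, Real.norm_eq_abs] at h
  have := (abs_sub_le_iff.mp h).2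
  linarith

/-- Under condition (K+Lcond) on `2M`, `(O⁺)^M Φ ≠ 0` (so `Ψ^{(M)}` (2.19) is well defined).
[cite: KomaTasaki1994, §5 (Bunbo), Theorem 2.4] -/
theorem orderPlus_pow_apply_ne_zero (hT : TowerState sys Φ μ γ) {M : ℕ} (hKL : KLCond sys μ γ (M + M)) :
    (sys.orderPlus ^ M) Φ ≠ 0 := by
  intro h0
  have h := hT.half_bm_le_norm_sq hKL
  rw [h0, norm_zero] at h
  have := hT.bm_pos M
  linarith

end TowerState

end Literature.MathematicalPhysics.QuantumLattice.KomaTasaki
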